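import Summits.ResolutionOfSingularities.ResolutionOfSingularities.Theorems.PlanarCutRows
import HarnessLib

/-!
# PlanarCutMoves — decomp-res node «PlanarCut» (lens-5 g18 rev 1), tree file 3/5: the TWO INEQUALITIES of the
strict multiplicity under
planar moves (monotone; HALVES at a planar proximity repeat) and DEAD LAYERS (a translated planar move from a state
all of whose wall layers
are monomial-led kills the wall).  State level, PROVED.

Content VERBATIM from the decomp-res lens-5 g18 file `HOME/decomp-res-lens-5/g18/parts/PlanarCut-REV1-155d4ffb.lean`
(sha256 155d4ffbaf2b8fc3; the REV1
pin the critic graded, CRITIC-LEDGER rows 119 + 119a CLEARED: DECIDED +1 · MAP +1; supersedes the NODE pin b3c721b9).  HOME =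
run/shared/lean/pub/decomp-res.  Host: route `MaxContactCut`, aside 31770 `MaxContactCut.DefectWalksDeep` BY NAME
through the tree's
`ExitLaw.defectWalksDeep_iff_joint'` (`Theorems/MaxContactCutExitLaw`).

[WRITER NOTE (decomp-res writer g6): the lens file is split into `PlanarCutStates` (§1–§4 state level) →
`PlanarCutRows` (the Taylor row of a
layer) → `PlanarCutMoves` (strict-multiplicity inequalities, dead layers) → `PlanarCutWalks` (§5 walk level:
potential, descent, kill) →
`MaxContactCutPlanarCut` (§6/§6b classes + `closes` BY NAME); `set_option` lines dropped; §7 adapters (VERBATIM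
restatements of lens-5 g17
`TransportCut` / lens-3 g15 `ConeCut` classes) are NOT landed here — they follow once `Theorems/TransportCut*` /
`ConeCut*` are in the tree
(critic row 119: import, do not duplicate).  All files sit inside the Theses cone (the exit-law walk model
`ExitLawStates` imports the
route's itinerary model), so the §6 classes are booked as TREE THEOREMS / docstrings, not as route asides.]
(Sources: Hauser2010 §§D–G; HauserPerlega2019; CossartJannsenSaito2020 Thm. 2.14; CossartPiltant2019; Moh1987.)
-/

noncomputable section

open MvPolynomial Finset
open Literature.AlgebraicGeometry.Resolution
open Literature.AlgebraicGeometry.Resolution.Hauser2010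
open Literature.AlgebraicGeometry.Resolution.PointBlowup
open Literature.AlgebraicGeometry.Resolution.WeightedBlowup
open Summit.ResolutionOfSingularities.ResolutionOfSingularities.Theses
open Summit.ResolutionOfSingularities.ResolutionOfSingularities.Theorems.TightDefectClasses
open Summit.ResolutionOfSingularities.ResolutionOfSingularities.Theorems.TightDefectStrongWalks
open Summit.ResolutionOfSingularities.ResolutionOfSingularities.Theorems.ItineraryCutClasses
open Summit.ResolutionOfSingularities.ResolutionOfSingularities.Theorems.BoundaryLedger
open Summit.ResolutionOfSingularities.ResolutionOfSingularities.Theorems.ProximityCut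
open Summit.ResolutionOfSingularities.ResolutionOfSingularities.Theorems.ExitLaw

namespace Summit.ResolutionOfSingularities.ResolutionOfSingularities.Theorems.PlanarCut

section Planar

variable {K : Type} [Field K] [DecidableEq K]

variable {i j k : Fin 3} (hij : i ≠ j) (hjk : j ≠ k) (hik : i ≠ k)
include hij hjk hik

/-! ### The two inequalities of the strict multiplicity under planar moves (state level) -/

/-- **MONOTONICITY (PROVED).**  The strict multiplicity of every wall layer `1 … q−1` does not increase under a
planar move. [new] [folklore] -/
theorem sm_step_le (q : ℕ) (b : Fin 3 → K) (hbj : b j = 0) (hbk : b k = 0) (s : State (Fin 3) K)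
    (hF : ∀ d ∈ s.F.support, q ≤ d.degree) {a : ℕ} (ha1 : 1 ≤ a) (haq : a < q) :
    sm (layer k a (step q j b s).F) i j ≤ sm (layer k a s.F) i j := by
  classical
  by_cases hne : (layer k a s.F).Nonempty
  · obtain ⟨dstar, hmem, hj', hi'⟩ := exists_low_exponent hij hjk hik q b hbj hbk s hF ha1 haq hne
    have h2 : lo (layer k a (step q j b s).F) j ≤ dstar j := lo_le hmem j
    have h3 : loSum (layer k a (step q j b s).F) i j ≤ dstar i + dstar j := loSum_le hmem i j
    have h4 : lo (layer k a (step q j b s).F) i + lo (layer k a (step q j b s).F) j ≤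
        loSum (layer k a (step q j b s).F) i j := lo_add_lo_le_loSum i j
    have h5 : loSum (layer k a s.F) i j + a - q ≤ lo (layer k a (step q j b s).F) j := by
      apply le_lo ⟨_, hmem⟩
      intro d' hd'
      obtain ⟨d, hd, hline, -, -⟩ := origin_of_mem_layer_step hij hjk hik q b hbj hbk s hF hd'
      have := loSum_le hd i j
      omega
    have hxy : lo (layer k a s.F) i + lo (layer k a s.F) j ≤ loSum (layer k a s.F) i j := lo_add_lo_le_loSum i j
    unfold sm at hi' ⊢
    omega
  · rw [Finset.not_nonempty_iff_eq_empty] at hne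
    rw [layer_step_eq_empty hij hjk hik q b hbj hbk s hF hne, hne]

/-- **PROXIMITY INEQUALITY (PROVED).**  A planar move followed by an UNTRANSLATED planar move in the OTHER chart
(a planar proximity repeat): `sm'' + sm' ≤ sm` layer by layer — the new strict multiplicity after the repeat is at
most HALF the old one.  (The surface shadow of the curve fact «after blowing up a point of multiplicity `m`, the
multiplicities at the two axis points of the exceptional line sum to at most `m`».) [new] [folklore] -/
theorem sm_step_step_le (q : ℕ) (b : Fin 3 → K) (hbj : b j = 0) (hbk : b k = 0) (s : State (Fin 3) K)
    (hF : ∀ d ∈ s.F.support, q ≤ d.degree) (hF' : ∀ d ∈ (step q j b s).F.support, q ≤ d.degree)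
    {a : ℕ} (ha1 : 1 ≤ a) (haq : a < q) :
    sm (layer k a (step q i (0 : Fin 3 → K) (step q j b s)).F) i j + sm (layer k a (step q j b s).F) i j ≤
      sm (layer k a s.F) i j := by
  classical
  by_cases hne : (layer k a s.F).Nonempty
  · obtain ⟨dstar, hmem, hj', hi'⟩ := exists_low_exponent hij hjk hik q b hbj hbk s hF ha1 haq hne
    have h2 : lo (layer k a (step q j b s).F) j ≤ dstar j := lo_le hmem j
    have h4 : lo (layer k a (step q j b s).F) i + lo (layer k a (step q j b s).F) j ≤
        loSum (layer k a (step q j b s).F) i j := lo_add_lo_le_loSum i j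
    have h5 : loSum (layer k a s.F) i j + a - q ≤ lo (layer k a (step q j b s).F) j := by
      apply le_lo ⟨_, hmem⟩
      intro d' hd'
      obtain ⟨d, hd, hline, -, -⟩ := origin_of_mem_layer_step hij hjk hik q b hbj hbk s hF hd'
      have := loSum_le hd i j
      omega
    have hxy : lo (layer k a s.F) i + lo (layer k a s.F) j ≤ loSum (layer k a s.F) i j := lo_add_lo_le_loSum i j
    -- the second (untranslated) move, chart `u_i`: roles `(j, i, k)`
    have hmem2 : chartExponent q i dstar ∈ layer k a (step q i (0 : Fin 3 → K) (step q j b s)).F :=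
      chartExponent_mem_layer_step hik q (step q j b s) hF' ha1 haq hmem
    have hdi : chartExponent q i dstar i + q = dstar i + dstar j + a := by
      rw [chartExponent_self]
      have h6 := hF' dstar (Finset.mem_filter.mp hmem).1
      have h7 := degree_three hij hjk hik dstar
      have h8 : dstar k = a := (Finset.mem_filter.mp hmem).2
      omega
    have hdj : chartExponent q i dstar j = dstar j := chartExponent_i hij.symm q dstar
    have h9 : loSum (layer k a (step q i (0 : Fin 3 → K) (step q j b s)).F) i j ≤
        chartExponent q i dstar i + chartExponent q i dstar j := loSum_le hmem2 i j
    have h10 : lo (layer k a (step q i (0 : Fin 3 → K) (step q j b s)).F) i +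
        lo (layer k a (step q i (0 : Fin 3 → K) (step q j b s)).F) j ≤
        loSum (layer k a (step q i (0 : Fin 3 → K) (step q j b s)).F) i j := lo_add_lo_le_loSum i j
    have hls : loSum (layer k a (step q j b s).F) i j ≤ dstar i + dstar j := loSum_le hmem i j
    have hq' : q ≤ loSum (layer k a (step q j b s).F) i j + a := by
      obtain ⟨d', hd', hd'eq⟩ := exists_loSum_eq ⟨_, hmem⟩ i j
      have h6 := hF' d' (Finset.mem_filter.mp hd').1
      have h7 := degree_three hij hjk hik d'
      have h8 : d' k = a := (Finset.mem_filter.mp hd').2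
      omega
    have h11 : loSum (layer k a (step q j b s).F) i j + a - q ≤
        lo (layer k a (step q i (0 : Fin 3 → K) (step q j b s)).F) i := by
      apply le_lo ⟨_, hmem2⟩
      intro d'' hd''
      obtain ⟨d', hd', hline, -, -⟩ :=
        origin_of_mem_layer_step hij.symm hik hjk q (0 : Fin 3 → K) rfl rfl (step q j b s) hF' hd''
      have := loSum_le hd' i j
      omega
    have h12 : lo (layer k a (step q j b s).F) j ≤ lo (layer k a (step q i (0 : Fin 3 → K) (step q j b s)).F) j := by
      apply le_lo ⟨_, hmem2⟩
      intro d'' hd''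
      obtain ⟨d', hd', -, -, heq⟩ :=
        origin_of_mem_layer_step hij.symm hik hjk q (0 : Fin 3 → K) rfl rfl (step q j b s) hF' hd''
      rw [heq rfl]
      exact lo_le hd' j
    unfold sm at hi' ⊢
    omega
  · rw [Finset.not_nonempty_iff_eq_empty] at hne
    have h1 := layer_step_eq_empty hij hjk hik q b hbj hbk s hF hne
    have h2 := layer_step_eq_empty hij.symm hik hjk q (0 : Fin 3 → K) rfl rfl (step q j b s) hF' h1
    rw [h1, h2, hne, sm_empty]

/-! ### Dead layers: a translated planar move from a state all of whose wall layers are monomial-led is fat -/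

/-- **FATNESS (PROVED).**  If the wall layer `0` is empty (`u_k ∣ F`) and every layer `1 … q−1` is MONOMIAL-LED
(`sm = 0`), then after a TRANSLATED planar move (`b_i ≠ 0`) every monomial of the new state has `d_j + d_k ≥ q`:
the lowest new row of layer `a` is `c · (u_i + b_i)^{x₀} u_j^{Y} u_k^{a}` with the PURE POWER `u_j^Y u_k^a` present,
so `Y + a ≥ q` by the order bound, and every other new exponent of the layer lies on or above that row. [new] [folklore] -/
theorem fat_of_dead_layers (q : ℕ) (b : Fin 3 → K) (hbj : b j = 0) (hbk : b k = 0) (hbi : b i ≠ 0)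
    (s : State (Fin 3) K) (hF : ∀ d ∈ s.F.support, q ≤ d.degree)
    (hF' : ∀ d ∈ (step q j b s).F.support, q ≤ d.degree) (h0 : layer k 0 s.F = ∅)
    (hdead : ∀ a, 1 ≤ a → a < q → sm (layer k a s.F) i j = 0) :
    ∀ d' ∈ (step q j b s).F.support, q ≤ (Finsupp.erase i d').degree := by
  classical
  intro d' hd'
  have hdeg := degree_erase_add d' i
  have h3 := degree_three hij hjk hik d'
  obtain ⟨a, ha⟩ : ∃ a, d' k = a := ⟨_, rfl⟩
  by_cases haq : a < q
  · rcases Nat.eq_zero_or_pos a with ha0 | ha1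
    · exfalso
      have hmem : d' ∈ layer k 0 (step q j b s).F :=
        mem_layer.mpr ⟨MvPolynomial.mem_support_iff.mp hd', by rw [ha, ha0]⟩
      rw [layer_step_eq_empty hij hjk hik q b hbj hbk s hF h0] at hmem
      exact absurd hmem (Finset.notMem_empty _)
    · have hmem : d' ∈ layer k a (step q j b s).F := mem_layer.mpr ⟨MvPolynomial.mem_support_iff.mp hd', ha⟩
      have hne : (layer k a s.F).Nonempty := by
        by_contra hne
        rw [Finset.not_nonempty_iff_eq_empty] at hne
        rw [layer_step_eq_empty hij hjk hik q b hbj hbk s hF hne] at hmem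
        exact absurd hmem (Finset.notMem_empty _)
      obtain ⟨d₁, hd₁S, hd₁⟩ := exists_loSum_eq hne i j
      have hq : q ≤ loSum (layer k a s.F) i j + a := by
        have h1 := hF d₁ (Finset.mem_filter.mp hd₁S).1
        have h2 := degree_three hij hjk hik d₁
        have h4 : d₁ k = a := (Finset.mem_filter.mp hd₁S).2
        omega
      -- the row at `n₀` is the single exponent `d₁ = (x₀, y₀, a)`
      have hsm := hdead a ha1 haq
      have hxy : lo (layer k a s.F) i + lo (layer k a s.F) j ≤ loSum (layer k a s.F) i j :=
        lo_add_lo_le_loSum i j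
      have hrow : ∀ d ∈ (layer k a s.F).filter (fun d => d i + d j = loSum (layer k a s.F) i j), d = d₁ := by
        intro d hd
        have hd0 := (Finset.mem_filter.mp hd)
        have e1 := lo_le hd0.1 i
        have e2 := lo_le hd0.1 j
        have e3 := lo_le hd₁S i
        have e4 := lo_le hd₁S j
        unfold sm at hsm
        exact eq_of_row hij hjk hik hd (Finset.mem_filter.mpr ⟨hd₁S, hd₁⟩) (by omega)
      have hc0 : (rowPoly i j k a (loSum (layer k a s.F) i j) (b i) s.F).coeff 0 ≠ 0 := by
        rw [coeff_rowPoly, Finset.sum_eq_single d₁]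
        · rw [Nat.choose_zero_right, Nat.cast_one, one_mul, Nat.sub_zero]
          exact mul_ne_zero (MvPolynomial.mem_support_iff.mp (Finset.mem_filter.mp hd₁S).1) (pow_ne_zero _ hbi)
        · intro d hd hne'
          exact absurd (hrow d hd) hne'
        · intro h'
          exact absurd (Finset.mem_filter.mpr ⟨hd₁S, hd₁⟩) h'
      have hpure : exp3 i j k 0 (loSum (layer k a s.F) i j + a - q) a ∈ (step q j b s).F.support := by
        rw [MvPolynomial.mem_support_iff, coeff_step_lowest_row hij hjk hik q b hbj hbk s hF ha1 haq hq]
        exact hc0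
      have h5 := hF' _ hpure
      rw [degree_three hij hjk hik, exp3_i hij hik, exp3_j hij hjk, exp3_k hjk hik] at h5
      obtain ⟨d, hd, hline, -, -⟩ := origin_of_mem_layer_step hij hjk hik q b hbj hbk s hF hmem
      have h6 := loSum_le hd i j
      omega
  · omega

omit hij hjk hik [DecidableEq K] in
/-- **FAT STATES ARE NOT ISOLATED (PROVED)** — the isolation half of the tree's axis law `noAxisTails_holds`, isolated
as a lemma: if every monomial of `F` has off-`i` degree `≥ q`, the top locus of `Z^q + F` contains the `u_i`-axis.
[folklore] -/
theorem not_isolatedTop_of_fat [DecidableEq K] (q : ℕ) (i : Fin 3) (F : MvPolynomial (Fin 3) K)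
    (hfat : ∀ d ∈ F.support, q ≤ (Finsupp.erase i d).degree) : ¬ IsolatedTop q F := by
  classical
  rintro ⟨N₀, g, hg0, hg⟩
  have hker : topIdeal q F ≤ RingHom.ker (aeval (axisMap K i)).toRingHom := by
    unfold topIdeal
    rw [Ideal.span_le]
    rintro _ ⟨c, ⟨-, hc⟩, rfl⟩
    rw [SetLike.mem_coe, RingHom.mem_ker]
    exact aeval_axisMap_hasseDeriv_eq_zero i _ hfat c hc
  have h0 := hker (hg i)
  rw [RingHom.mem_ker] at h0
  change aeval (axisMap K i) (g * X i ^ N₀) = 0 at h0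
  rw [map_mul, map_pow, aeval_X] at h0
  have hX : axisMap K i i = X i := by unfold axisMap; rw [if_pos rfl]
  rw [hX] at h0
  have hg' : aeval (axisMap K i) g = 0 :=
    (mul_eq_zero.mp h0).resolve_right (pow_ne_zero _ (X_ne_zero i))
  apply hg0
  rw [← constantCoeff_aeval_axisMap i g, hg', map_zero]

end Planar

end Summit.ResolutionOfSingularities.ResolutionOfSingularities.Theorems.PlanarCut
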